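import Summits.HubbardSuperconductivity.HubbardSuperconductivity.Theorems.TwTipContinuation.Negative.TipNormalForm
import Summits.HubbardSuperconductivity.HubbardSuperconductivity.Theorems.BalabanIRBirEveryGroundStateSchur
import Summits.HubbardSuperconductivity.HubbardSuperconductivity.Theorems.BalabanIRBirGroundStateAverageLRO
import Literature.MathematicalPhysics.QuantumLattice.FockRelabel

/-!
# `TwTipContinuation` (stmt-HubbardSuperconductivity-1700), line `isogap-submodular-transport`:
# the every-GS layer `stub_groundSpaceHomogeneity` — Schur reduction and conditional forms

Supports the crux `…Theses.ThermalWedge.TwTipContinuation` (route `ThermalWedge`, rank 6). The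
registered stub `stub_groundSpaceHomogeneity` asks: for every `δ ∈ [1/10, 2/5]` there is `U₁ > 0` such
that for all `U ∈ (0, U₁]` and `ε > 0`, eventually in even `L`, any two normalised ground states of the
PURE torus `hubbardTorus 2 L 1 U` in the sector `(2⌊(1-δ)L²/2⌋, S^z = 0)` have `d`-wave pair
intensities `re ⟨ψ, P_L ψ⟩`, `P_L = (pairField d L)ᴴ (pairField d L)`, within `ε L⁴`. This concerns
the exact ground eigenspaces `E₀(U, L)` of the weakly repulsive Hubbard torus at all large even sides
and is neither proved nor refuted here. Landed instead (all folklore linear algebra):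
* scalar matrix elements `⟨w, A v⟩ = μ ⟨w, v⟩` on a subspace `K` ⇒ equal `re ⟨ψ, A ψ⟩` at all unit
  `ψ ∈ K` (`re_rayleigh_eq_of_scalar`), and CONVERSELY for Hermitian `A` by normalisation +
  polarization (`exists_scalar_matrixElements_of_re_rayleigh_eq`): at `ε = 0` the stub at side `L`
  IS "the compression of `P_L` to `E₀` is a scalar" (`scalarOnGround_iff_re_expect_eq`);
  `dim K ≤ 1` ⇒ scalar (`exists_scalar_matrixElements_of_finrank_le_one`); Schur on a joint
  eigenspace `S ⊓ ker (H − e)` for a `ᴴ`-closed family of symmetries of `H` and `A` preserving `S`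
  (`exists_scalar_matrixElements_inf_eigenspace_of_irreducible`);
* the lattice-symmetry unitaries of side `L` — translations `fockTranslate v` and the point group
  `fockD4 γ`, `γ ∈ D₄` (tree file `FockRelabel`) — are `ᴴ`-closed, commute with `hubbardTorus 2 L t U`
  AND with `P_L` (`U_γ Δ_d U_γᴴ = χ_{B₁g}(γ) Δ_d`, `χ² = 1`: the sign structure of `Δ_d` never reaches
  `P_L`) and preserve every joint sector (`latticeSymmetry_props`); so an IRREDUCIBLE lattice
  multiplet `E₀(U, L)` (e.g. a non-degenerate level, or the span of the `D₄` images of a ground state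
  of crystal momentum `k ≠ 0` degenerate with nothing else) carries a scalar compression of `P_L`
  (`scalarOnGround_of_irreducible_latticeSymmetry`);
* the stub's conclusion, verbatim, from eventual scalar ground compressions / lattice irreducibility /
  simplicity of the ground level for all `U ∈ (0, U₁]` (`stub_groundSpaceHomogeneity_of_scalarOnGround`,
  `…_of_irreducible`, `…_of_simple`).
What remains open (the bet): at each small `U > 0`, absence at all large even `L` of ACCIDENTAL
degeneracies of the sector ground level between inequivalent or repeated lattice multiplets with
pair-intensity densities differing by `≥ ε`. Operators commuting with the whole family (`S²`, the
spin flip) cannot make a reducible `E₀` irreducible; the uniqueness theorems of Lieb (1989) need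
`U < 0` or half filling. Sources: Tasaki, *Physics and Mathematics of Quantum Many-Body Systems*
(2020) §2.2, App. A.2; Serre, *Linear Representations of Finite Groups* §2.2; Scalapino, Phys. Rep.
250 (1995) 329, §2. No definition is introduced.
-/

noncomputable section

namespace Summit.HubbardSuperconductivity.TwTipContinuation.IsogapTransport

open Matrix Filter Finset
open Literature.MathematicalPhysics.QuantumLattice Literature.Probability.LatticeModels
open Summit.HubbardSuperconductivity.TwTipContinuation.Negative
open Summit.HubbardSuperconductivity.HubbardSuperconductivity.Theorems
open scoped ComplexOrder

/-! ### Linear algebra: scalar compression ⇔ constant Rayleigh quotient on the unit sphere -/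

section LinearAlgebra

variable {n : Type*} [Fintype n] [DecidableEq n]

omit [DecidableEq n] in
/-- If the matrix elements of `A` on `K` are those of a scalar, `⟨w, A v⟩ = μ ⟨w, v⟩`, then all unit
vectors of `K` have the same expectation `re ⟨ψ, A ψ⟩ = re μ`. [folklore] -/
theorem re_rayleigh_eq_of_scalar (K : Submodule ℂ (n → ℂ)) (A : Matrix n n ℂ)
    (hscal : ∃ μ : ℂ, ∀ v ∈ K, ∀ w ∈ K, star w ⬝ᵥ A *ᵥ v = μ * (star w ⬝ᵥ v))
    {ψ ψ' : n → ℂ} (hψ : ψ ∈ K) (hψ' : ψ' ∈ K) (h1 : star ψ ⬝ᵥ ψ = 1)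
    (h1' : star ψ' ⬝ᵥ ψ' = 1) :
    (star ψ ⬝ᵥ A *ᵥ ψ).re = (star ψ' ⬝ᵥ A *ᵥ ψ').re := by
  obtain ⟨μ, hμ⟩ := hscal
  rw [hμ ψ hψ ψ hψ, hμ ψ' hψ' ψ' hψ', h1, h1']

omit [DecidableEq n] in
/-- **Polarization** for the form `(w, v) ↦ ⟨w, B v⟩ = star w ⬝ᵥ B v`:
`4⟨w, Bv⟩ = Σ_{λ⁴ = 1} conj λ · ⟨w + λv, B(w + λv)⟩`. [folklore] -/
theorem star_dotProduct_mulVec_polarization (B : Matrix n n ℂ) (w v : n → ℂ) :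
    star w ⬝ᵥ B *ᵥ v = (1 / 4 : ℂ) *
      (star (w + v) ⬝ᵥ B *ᵥ (w + v) - star (w - v) ⬝ᵥ B *ᵥ (w - v)
        - Complex.I * (star (w + Complex.I • v) ⬝ᵥ B *ᵥ (w + Complex.I • v))
        + Complex.I * (star (w - Complex.I • v) ⬝ᵥ B *ᵥ (w - Complex.I • v))) := by
  simp only [star_add, star_sub, star_smul, Complex.star_def, Complex.conj_I, mulVec_add,
    mulVec_sub, mulVec_smul, add_dotProduct, sub_dotProduct, dotProduct_add, dotProduct_sub,
    smul_dotProduct, dotProduct_smul, smul_eq_mul, neg_smul, neg_dotProduct]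
  ring_nf
  rw [Complex.I_sq]
  ring

/-- **Constant expectation on the unit sphere ⇒ scalar compression** (converse of
`re_rayleigh_eq_of_scalar`, Hermitian `A`): if `re ⟨ψ, A ψ⟩` is the same at all unit vectors of `K`,
then `⟨w, A v⟩ = μ ⟨w, v⟩` on `K` (normalise, then polarize `A − μ`). [folklore] -/
theorem exists_scalar_matrixElements_of_re_rayleigh_eq (K : Submodule ℂ (n → ℂ)) {A : Matrix n n ℂ}
    (hA : A.IsHermitian)
    (h : ∀ ψ ∈ K, ∀ ψ' ∈ K, star ψ ⬝ᵥ ψ = 1 → star ψ' ⬝ᵥ ψ' = 1 →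
      (star ψ ⬝ᵥ A *ᵥ ψ).re = (star ψ' ⬝ᵥ A *ᵥ ψ').re) :
    ∃ μ : ℂ, ∀ v ∈ K, ∀ w ∈ K, star w ⬝ᵥ A *ᵥ v = μ * (star w ⬝ᵥ v) := by
  by_cases hK : K = ⊥
  · refine ⟨0, fun v hv w _ => ?_⟩
    rw [hK, Submodule.mem_bot] at hv
    simp [hv]
  have him : ∀ x : n → ℂ, (star x ⬝ᵥ A *ᵥ x).im = 0 := fun x => by
    simpa only [RCLike.im_to_complex] using hA.im_star_dotProduct_mulVec_self x
  obtain ⟨ψ₀, hψ₀K, hψ₀⟩ := (Submodule.ne_bot_iff K).mp hK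
  obtain ⟨c, -, hunit⟩ := exists_smul_unit hψ₀
  set μ : ℂ := star (c • ψ₀) ⬝ᵥ A *ᵥ (c • ψ₀) with hμ
  -- Step 1: the quadratic form of `A` on `K` is `μ ‖v‖²`
  have hquad : ∀ v ∈ K, star v ⬝ᵥ A *ᵥ v = μ * (star v ⬝ᵥ v) := by
    intro v hv
    by_cases hv0 : v = 0
    · simp [hv0]
    obtain ⟨d, hd, hdu⟩ := exists_smul_unit hv0
    have hre := h (d • v) (K.smul_mem d hv) (c • ψ₀) (K.smul_mem c hψ₀K) hdu hunit
    have h1 : star (d • v) ⬝ᵥ A *ᵥ (d • v) = μ := Complex.ext hre (by rw [him, hμ, him])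
    have e1 : star (d • v) ⬝ᵥ A *ᵥ (d • v) = star d * d * (star v ⬝ᵥ A *ᵥ v) := by
      rw [star_smul, mulVec_smul, smul_dotProduct, dotProduct_smul, smul_eq_mul, smul_eq_mul,
        mul_assoc]
    have e2 : star (d • v) ⬝ᵥ (d • v) = star d * d * (star v ⬝ᵥ v) := by
      rw [star_smul, smul_dotProduct, dotProduct_smul, smul_eq_mul, smul_eq_mul, mul_assoc]
    have hdd : star d * d ≠ 0 := mul_ne_zero (star_ne_zero.mpr hd) hd
    rw [e2] at hdu
    rw [e1] at h1
    rw [(eq_inv_mul_iff_mul_eq₀ hdd).mpr h1, eq_inv_of_mul_eq_one_right hdu, mul_comm]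
  -- Step 2: polarize `B = A − μ`
  refine ⟨μ, fun v hv w hw => ?_⟩
  have hB : ∀ x ∈ K, star x ⬝ᵥ (A - μ • (1 : Matrix n n ℂ)) *ᵥ x = 0 := fun x hx => by
    rw [sub_mulVec, dotProduct_sub, smul_mulVec, one_mulVec, dotProduct_smul, smul_eq_mul,
      hquad x hx, sub_self]
  have key := star_dotProduct_mulVec_polarization (A - μ • (1 : Matrix n n ℂ)) w v
  rw [hB _ (K.add_mem hw hv), hB _ (K.sub_mem hw hv), hB _ (K.add_mem hw (K.smul_mem _ hv)),
    hB _ (K.sub_mem hw (K.smul_mem _ hv))] at key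
  rw [sub_mulVec, dotProduct_sub, smul_mulVec, one_mulVec, dotProduct_smul, smul_eq_mul] at key
  have : star w ⬝ᵥ A *ᵥ v - μ * (star w ⬝ᵥ v) = 0 := by rw [key]; ring
  exact sub_eq_zero.mp this

/-- A subspace of dimension `≤ 1` carries only scalar compressions (Schur with the empty family of
symmetries: a line has no proper non-zero subspace) — the case of a non-degenerate level. [folklore] -/
theorem exists_scalar_matrixElements_of_finrank_le_one (K : Submodule ℂ (n → ℂ))
    (hK : Module.finrank ℂ K ≤ 1) (A : Matrix n n ℂ) :
    ∃ μ : ℂ, ∀ v ∈ K, ∀ w ∈ K, star w ⬝ᵥ A *ᵥ v = μ * (star w ⬝ᵥ v) := by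
  refine exists_scalar_matrixElements_of_irreducible K A ∅ (by simp) (by simp) (by simp) ?_
  intro K' hK' _
  rcases Nat.lt_or_ge (Module.finrank ℂ K') 1 with h0 | h1
  · exact Or.inl (Submodule.finrank_eq_zero.mp (by omega))
  · exact Or.inr (Submodule.eq_of_le_of_finrank_le hK' (hK.trans h1))

/-- **Symmetries preserve the joint eigenspaces.** If `X` commutes with `H` and maps the subspace
`S` into itself, it maps `S ⊓ ker (H − e)` into itself. [folklore] -/
theorem mulVec_mem_inf_eigenspace_of_commute {H X : Matrix n n ℂ} (hXH : Commute X H)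
    (S : Submodule ℂ (n → ℂ)) (hXS : ∀ v ∈ S, X *ᵥ v ∈ S) (e : ℂ) {v : n → ℂ}
    (hv : v ∈ S ⊓ Module.End.eigenspace (Matrix.toLin' H) e) :
    X *ᵥ v ∈ S ⊓ Module.End.eigenspace (Matrix.toLin' H) e := by
  obtain ⟨hvS, hvE⟩ := Submodule.mem_inf.mp hv
  rw [Module.End.mem_eigenspace_iff, Matrix.toLin'_apply] at hvE
  refine Submodule.mem_inf.mpr ⟨hXS v hvS, ?_⟩
  rw [Module.End.mem_eigenspace_iff, Matrix.toLin'_apply, mulVec_mulVec, ← hXH.eq, ← mulVec_mulVec,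
    hvE, mulVec_smul]

/-- **Schur on a joint eigenspace.** Let `S` be a subspace, `H`, `A` matrices and `𝒮` a `ᴴ`-closed
family of matrices, each commuting with `H` and with `A` and mapping `S` into itself. If
`E = S ⊓ ker (H − e)` has no `𝒮`-invariant subspace other than `⊥` and `E`, then `A` has scalar
matrix elements on `E` (`exists_scalar_matrixElements_of_irreducible`; `E` is invariant under `X` and
`Xᴴ` by `mulVec_mem_inf_eigenspace_of_commute`). Serre §2.2; Tasaki (2020) App. A.2. [folklore] -/
theorem exists_scalar_matrixElements_inf_eigenspace_of_irreducible (S : Submodule ℂ (n → ℂ))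
    (H A : Matrix n n ℂ) (e : ℂ) (𝒮 : Set (Matrix n n ℂ)) (hadj : ∀ X ∈ 𝒮, Xᴴ ∈ 𝒮)
    (hSH : ∀ X ∈ 𝒮, Commute X H) (hSA : ∀ X ∈ 𝒮, X * A = A * X)
    (hSS : ∀ X ∈ 𝒮, ∀ v ∈ S, X *ᵥ v ∈ S)
    (hirr : ∀ K' : Submodule ℂ (n → ℂ), K' ≤ S ⊓ Module.End.eigenspace (Matrix.toLin' H) e →
      (∀ X ∈ 𝒮, ∀ v ∈ K', X *ᵥ v ∈ K') → K' = ⊥ ∨ K' = S ⊓ Module.End.eigenspace (Matrix.toLin' H) e) :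
    ∃ μ : ℂ, ∀ v ∈ S ⊓ Module.End.eigenspace (Matrix.toLin' H) e,
      ∀ w ∈ S ⊓ Module.End.eigenspace (Matrix.toLin' H) e, star w ⬝ᵥ A *ᵥ v = μ * (star w ⬝ᵥ v) :=
  exists_scalar_matrixElements_of_irreducible _ A 𝒮 hSA
    (fun X hX _ hv => mulVec_mem_inf_eigenspace_of_commute (hSH X hX) S (hSS X hX) e hv)
    (fun X hX _ hv => mulVec_mem_inf_eigenspace_of_commute (hSH _ (hadj X hX)) S (hSS _ (hadj X hX)) e hv)
    hirr

end LinearAlgebra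

/-! ### Sector ground states of a Hubbard-type Hamiltonian: scalar ground compression ⇔ homogeneity -/

section Sector

variable {Λ : Type*} [LinearOrder Λ] [Fintype Λ]

/-- A sector ground state lies in the sector ground eigenspace
`E₀ = szSector N M ⊓ ker (H − minEnergyOn H (szSector N M))`. [folklore] -/
theorem mem_groundEigenspace_of_isGroundStateInSector
    {H : Matrix (Finset (Orb Λ)) (Finset (Orb Λ)) ℂ} {N : ℕ} {M : ℝ} {ψ : Fock (Orb Λ)}
    (h : IsGroundStateInSector H N M ψ) :
    ψ ∈ szSector N M ⊓
      Module.End.eigenspace (Matrix.toLin' H) ((H.minEnergyOn (szSector N M) : ℝ) : ℂ) := by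
  refine Submodule.mem_inf.mpr ⟨h.1, ?_⟩
  rw [Module.End.mem_eigenspace_iff, Matrix.toLin'_apply]
  exact h.2.2

/-- **Scalar ground compression ⇒ every-GS homogeneity (exact).** If an observable `A` has scalar
matrix elements on the sector ground eigenspace `E₀` of `H`, then all normalised sector ground states
have the same expectation `re ⟨ψ, A ψ⟩`. [folklore] -/
theorem re_expect_eq_of_scalarOnGround (H A : Matrix (Finset (Orb Λ)) (Finset (Orb Λ)) ℂ) (N : ℕ)
    (M : ℝ)
    (hscal : ∃ μ : ℂ, ∀ v ∈ szSector N M ⊓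
        Module.End.eigenspace (Matrix.toLin' H) ((H.minEnergyOn (szSector N M) : ℝ) : ℂ),
      ∀ w ∈ szSector N M ⊓
        Module.End.eigenspace (Matrix.toLin' H) ((H.minEnergyOn (szSector N M) : ℝ) : ℂ),
        star w ⬝ᵥ A *ᵥ v = μ * (star w ⬝ᵥ v))
    {ψ ψ' : Fock (Orb Λ)} (h1 : star ψ ⬝ᵥ ψ = 1) (h1' : star ψ' ⬝ᵥ ψ' = 1)
    (hgs : IsGroundStateInSector H N M ψ) (hgs' : IsGroundStateInSector H N M ψ') :
    (expect A ψ).re = (expect A ψ').re :=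
  re_rayleigh_eq_of_scalar _ A hscal (mem_groundEigenspace_of_isGroundStateInSector hgs)
    (mem_groundEigenspace_of_isGroundStateInSector hgs') h1 h1'

/-- **… and conversely for a Hermitian observable** (e.g. `A = P_L`, Hermitian by
`(pairIntensity_posSemidef L).isHermitian`): exact every-GS homogeneity of `re ⟨ψ, A ψ⟩` over the
normalised sector ground states IS scalar ground compression of `A` — the `ε = 0` content of
`stub_groundSpaceHomogeneity` at one side. [folklore] -/
theorem scalarOnGround_iff_re_expect_eq (H : Matrix (Finset (Orb Λ)) (Finset (Orb Λ)) ℂ)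
    {A : Matrix (Finset (Orb Λ)) (Finset (Orb Λ)) ℂ} (hA : A.IsHermitian) (N : ℕ) (M : ℝ) :
    (∃ μ : ℂ, ∀ v ∈ szSector N M ⊓
        Module.End.eigenspace (Matrix.toLin' H) ((H.minEnergyOn (szSector N M) : ℝ) : ℂ),
      ∀ w ∈ szSector N M ⊓
        Module.End.eigenspace (Matrix.toLin' H) ((H.minEnergyOn (szSector N M) : ℝ) : ℂ),
        star w ⬝ᵥ A *ᵥ v = μ * (star w ⬝ᵥ v)) ↔
    ∀ ψ ψ' : Fock (Orb Λ), star ψ ⬝ᵥ ψ = 1 → star ψ' ⬝ᵥ ψ' = 1 →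
      IsGroundStateInSector H N M ψ → IsGroundStateInSector H N M ψ' →
        (expect A ψ).re = (expect A ψ').re := by
  refine ⟨fun hscal ψ ψ' h1 h1' hgs hgs' => re_expect_eq_of_scalarOnGround H A N M hscal h1 h1' hgs hgs',
    fun h => exists_scalar_matrixElements_of_re_rayleigh_eq _ hA fun ψ hψ ψ' hψ' h1 h1' => ?_⟩
  exact h ψ ψ' h1 h1' (isGroundStateInSector_of_mem_inf_eigenspace H N M hψ h1)
    (isGroundStateInSector_of_mem_inf_eigenspace H N M hψ' h1')

end Sector

/-! ### The torus: lattice symmetries commute with `P_L`; one-side homogeneity by Schur -/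

section Torus

variable {L : ℕ} [NeZero L]

/-- **The lattice-symmetry family of side `L`** — translations `U_v = fockTranslate v`, `v ∈ (ℤ/Lℤ)²`,
and the point group `U_γ = fockD4 γ`, `γ ∈ D₄` — is closed under `ᴴ`, commutes with
`hubbardTorus 2 L t U` and with `P_L = Δ_dᴴ Δ_d` (the `B₁g` sign of `Δ_d` squares away), and preserves
every joint sector `(N, S^z = M)`. Scalapino, Phys. Rep. 250 (1995) 329, §2. [folklore] -/
theorem latticeSymmetry_props (t U : ℝ) (N : ℕ) (M : ℝ) :
    ∀ X ∈ (Set.range fun v : TorusSite 2 L => (fockTranslate v).val) ∪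
        Set.range fun γ : DihedralGroup 4 => (fockD4 (L := L) γ).val,
      (Xᴴ ∈ (Set.range fun v : TorusSite 2 L => (fockTranslate v).val) ∪
          Set.range fun γ : DihedralGroup 4 => (fockD4 (L := L) γ).val) ∧
      Commute X (hubbardTorus 2 L t U) ∧
      X * ((pairField dWaveFormFactor L)ᴴ * pairField dWaveFormFactor L) =
        ((pairField dWaveFormFactor L)ᴴ * pairField dWaveFormFactor L) * X ∧
      ∀ ψ ∈ szSector (Λ := FermionTorus 2 L) N M, X *ᵥ ψ ∈ szSector (Λ := FermionTorus 2 L) N M := by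
  rintro X (⟨v, rfl⟩ | ⟨γ, rfl⟩)
  · -- `U_vᴴ = U_{-v}`; `U_v Δ_d U_vᴴ = Δ_d` (`relabel_translate_pairField_conjTranspose_mul`)
    refine ⟨Or.inl ⟨-v, show (fockTranslate (-v)).val = _ by rw [fockTranslate_neg]; rfl⟩,
      fockTranslate_commute_hubbardTorus v t U,
      (fockRelabel_commute_of_relabel_eq _
        (relabel_translate_pairField_conjTranspose_mul dWaveFormFactor v)).eq,
      fun ψ hψ => fockTranslate_mulVec_mem_szSector v hψ⟩
  · -- `U_γᴴ = U_{γ⁻¹}`; `U_γ Δ_d U_γᴴ = χ_{B₁g}(γ) Δ_d`, `χ² = 1` (`relabel_d4Perm_pairField_conjTranspose_mul`)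
    refine ⟨Or.inr ⟨γ⁻¹, show (fockD4 γ⁻¹).val = _ by rw [map_inv]; rfl⟩, fockD4_commute_hubbardTorus γ t U,
      (fockRelabel_commute_of_relabel_eq _
        (relabel_d4Perm_pairField_conjTranspose_mul γ dWaveFormFactor (Or.inr (Or.inr rfl)))).eq,
      fun ψ hψ => fockD4_mulVec_mem_szSector γ hψ⟩

/-- **Schur for the torus (one side): irreducible lattice multiplet ⇒ scalar ground compression of
`P_L`.** If the sector ground eigenspace `E₀` of `hubbardTorus 2 L t U` in the sector `(N, S^z = M)`
has no subspace invariant under all translations and all of `D₄` other than `⊥` and `E₀`, then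
`P_L` has scalar matrix elements on `E₀`. Tasaki (2020) App. A.2; Scalapino (1995) §2. [folklore] -/
theorem scalarOnGround_of_irreducible_latticeSymmetry (t U : ℝ) (N : ℕ) (M : ℝ)
    (hirr : ∀ K' : Submodule ℂ (Fock (Orb (FermionTorus 2 L))),
      K' ≤ szSector N M ⊓ Module.End.eigenspace (Matrix.toLin' (hubbardTorus 2 L t U))
          (((hubbardTorus 2 L t U).minEnergyOn (szSector N M) : ℝ) : ℂ) →
      (∀ X ∈ (Set.range fun v : TorusSite 2 L => (fockTranslate v).val) ∪
          Set.range fun γ : DihedralGroup 4 => (fockD4 (L := L) γ).val, ∀ v ∈ K', X *ᵥ v ∈ K') →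
      K' = ⊥ ∨ K' = szSector N M ⊓ Module.End.eigenspace (Matrix.toLin' (hubbardTorus 2 L t U))
          (((hubbardTorus 2 L t U).minEnergyOn (szSector N M) : ℝ) : ℂ)) :
    ∃ μ : ℂ, ∀ v ∈ szSector N M ⊓ Module.End.eigenspace (Matrix.toLin' (hubbardTorus 2 L t U))
          (((hubbardTorus 2 L t U).minEnergyOn (szSector N M) : ℝ) : ℂ),
      ∀ w ∈ szSector N M ⊓ Module.End.eigenspace (Matrix.toLin' (hubbardTorus 2 L t U))
          (((hubbardTorus 2 L t U).minEnergyOn (szSector N M) : ℝ) : ℂ),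
        star w ⬝ᵥ ((pairField dWaveFormFactor L)ᴴ * pairField dWaveFormFactor L) *ᵥ v =
          μ * (star w ⬝ᵥ v) := by
  have hp := latticeSymmetry_props (L := L) t U N M
  exact exists_scalar_matrixElements_inf_eigenspace_of_irreducible (szSector N M)
    (hubbardTorus 2 L t U) ((pairField dWaveFormFactor L)ᴴ * pairField dWaveFormFactor L) _
    ((Set.range fun v : TorusSite 2 L => (fockTranslate v).val) ∪
      Set.range fun γ : DihedralGroup 4 => (fockD4 (L := L) γ).val)
    (fun X hX => (hp X hX).1) (fun X hX => (hp X hX).2.1) (fun X hX => (hp X hX).2.2.1)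
    (fun X hX => (hp X hX).2.2.2) hirr

end Torus

/-! ### The conditional forms of `stub_groundSpaceHomogeneity` -/

/-- **Homogeneity at `(δ, U)` from eventual scalar ground compressions.** If, eventually in even `L`,
`P_L = Δ_dᴴ Δ_d` has scalar matrix elements on the sector ground eigenspace `E₀(U, L)` of
`hubbardTorus 2 L 1 U` (sector `(2⌊(1-δ)L²/2⌋, S^z = 0)`), then the homogeneity inequality of the stub
holds at `(δ, U)` for every `ε ≥ 0` (indeed with equal pair intensities). [folklore] -/
theorem groundSpaceHomogeneity_of_eventually_scalarOnGround {δ U : ℝ}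
    (h : ∃ L₀ : ℕ, ∀ (L : ℕ) [NeZero L], L₀ ≤ L → Even L →
      let N : ℕ := 2 * ⌊(1 - δ) * (L : ℝ) ^ 2 / 2⌋₊
      let H := hubbardTorus 2 L 1 U
      let S := szSector (Λ := FermionTorus 2 L) N 0
      let E₀ := S ⊓ Module.End.eigenspace (Matrix.toLin' H) ((H.minEnergyOn S : ℝ) : ℂ)
      ∃ μ : ℂ, ∀ v ∈ E₀, ∀ w ∈ E₀,
        star w ⬝ᵥ ((pairField dWaveFormFactor L)ᴴ * pairField dWaveFormFactor L) *ᵥ v =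
          μ * (star w ⬝ᵥ v)) :
    ∀ ε : ℝ, 0 ≤ ε → ∃ L₀ : ℕ, ∀ (L : ℕ) [NeZero L], L₀ ≤ L → Even L →
      ∀ ψ ψ' : Fock (Orb (FermionTorus 2 L)), star ψ ⬝ᵥ ψ = 1 → star ψ' ⬝ᵥ ψ' = 1 →
        IsGroundStateInSector (hubbardTorus 2 L 1 U) (2 * ⌊(1 - δ) * (L : ℝ) ^ 2 / 2⌋₊) 0 ψ →
        IsGroundStateInSector (hubbardTorus 2 L 1 U) (2 * ⌊(1 - δ) * (L : ℝ) ^ 2 / 2⌋₊) 0 ψ' →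
          (expect ((pairField dWaveFormFactor L)ᴴ * pairField dWaveFormFactor L) ψ).re ≤
            (expect ((pairField dWaveFormFactor L)ᴴ * pairField dWaveFormFactor L) ψ').re + ε * (L : ℝ) ^ 4 := by
  obtain ⟨L₀, hL₀⟩ := h
  intro ε hε
  refine ⟨L₀, fun L _ hL hE ψ ψ' h1 h1' hgs hgs' => ?_⟩
  have heq := re_expect_eq_of_scalarOnGround (hubbardTorus 2 L 1 U)
    ((pairField dWaveFormFactor L)ᴴ * pairField dWaveFormFactor L) _ 0 (hL₀ L hL hE) h1 h1' hgs hgs'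
  rw [heq]
  have : (0 : ℝ) ≤ ε * (L : ℝ) ^ 4 := by positivity
  linarith

/-- **The conditional stub (scalar form).** `stub_groundSpaceHomogeneity` follows, with its
conclusion verbatim, from: for every doping of the window there is `U₁ > 0` such that for all
`U ∈ (0, U₁]`, eventually in even `L`, `P_L` has scalar matrix elements on the sector ground
eigenspace of the pure torus (side by side and at `ε = 0` this is also necessary,
`scalarOnGround_iff_re_expect_eq`). The hypothesis is NOT proved here. Tasaki (2020) §2.2. [folklore] -/
theorem stub_groundSpaceHomogeneity_of_scalarOnGround :
    (∀ δ ∈ Set.Icc (1 / 10 : ℝ) (2 / 5), ∃ U₁ : ℝ, 0 < U₁ ∧ ∀ U ∈ Set.Ioc (0 : ℝ) U₁,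
      ∃ L₀ : ℕ, ∀ (L : ℕ) [NeZero L], L₀ ≤ L → Even L →
      ∃ μ : ℂ, ∀ v ∈ szSector (Λ := FermionTorus 2 L) (2 * ⌊(1 - δ) * (L : ℝ) ^ 2 / 2⌋₊) 0 ⊓ Module.End.eigenspace (Matrix.toLin' (hubbardTorus 2 L 1 U)) (((hubbardTorus 2 L 1 U).minEnergyOn (szSector (Λ := FermionTorus 2 L) (2 * ⌊(1 - δ) * (L : ℝ) ^ 2 / 2⌋₊) 0) : ℝ) : ℂ),
        ∀ w ∈ szSector (Λ := FermionTorus 2 L) (2 * ⌊(1 - δ) * (L : ℝ) ^ 2 / 2⌋₊) 0 ⊓ Module.End.eigenspace (Matrix.toLin' (hubbardTorus 2 L 1 U)) (((hubbardTorus 2 L 1 U).minEnergyOn (szSector (Λ := FermionTorus 2 L) (2 * ⌊(1 - δ) * (L : ℝ) ^ 2 / 2⌋₊) 0) : ℝ) : ℂ),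
        star w ⬝ᵥ ((pairField dWaveFormFactor L)ᴴ * pairField dWaveFormFactor L) *ᵥ v = μ * (star w ⬝ᵥ v)) →
    ∀ δ ∈ Set.Icc (1 / 10 : ℝ) (2 / 5), ∃ U₁ : ℝ, 0 < U₁ ∧ ∀ U ∈ Set.Ioc (0 : ℝ) U₁, ∀ ε : ℝ, 0 < ε →
      ∃ L₀ : ℕ, ∀ (L : ℕ) [NeZero L], L₀ ≤ L → Even L →
      ∀ ψ ψ' : Fock (Orb (FermionTorus 2 L)), star ψ ⬝ᵥ ψ = 1 → star ψ' ⬝ᵥ ψ' = 1 →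
        IsGroundStateInSector (hubbardTorus 2 L 1 U) (2 * ⌊(1 - δ) * (L : ℝ) ^ 2 / 2⌋₊) 0 ψ →
        IsGroundStateInSector (hubbardTorus 2 L 1 U) (2 * ⌊(1 - δ) * (L : ℝ) ^ 2 / 2⌋₊) 0 ψ' →
          (expect ((pairField dWaveFormFactor L)ᴴ * pairField dWaveFormFactor L) ψ).re ≤
            (expect ((pairField dWaveFormFactor L)ᴴ * pairField dWaveFormFactor L) ψ').re + ε * (L : ℝ) ^ 4 := by
  intro h δ hδ
  obtain ⟨U₁, hU₁, hU⟩ := h δ hδ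
  exact ⟨U₁, hU₁, fun U hUm ε hε =>
    groundSpaceHomogeneity_of_eventually_scalarOnGround (hU U hUm) ε hε.le⟩

/-- **The conditional stub (Schur form).** `stub_groundSpaceHomogeneity` follows from: for every
doping of the window there is `U₁ > 0` such that for all `U ∈ (0, U₁]`, eventually in even `L`, the
sector ground eigenspace of `hubbardTorus 2 L 1 U` is an irreducible multiplet of the lattice
symmetries (translations and `D₄`) — no accidental ground degeneracy. NOT proved here.
Tasaki (2020) App. A.2. [folklore] -/
theorem stub_groundSpaceHomogeneity_of_irreducible
    (h : ∀ δ ∈ Set.Icc (1 / 10 : ℝ) (2 / 5), ∃ U₁ : ℝ, 0 < U₁ ∧ ∀ U ∈ Set.Ioc (0 : ℝ) U₁,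
      ∃ L₀ : ℕ, ∀ (L : ℕ) [NeZero L], L₀ ≤ L → Even L →
      let N : ℕ := 2 * ⌊(1 - δ) * (L : ℝ) ^ 2 / 2⌋₊
      let H := hubbardTorus 2 L 1 U
      let S := szSector (Λ := FermionTorus 2 L) N 0
      let E₀ := S ⊓ Module.End.eigenspace (Matrix.toLin' H) ((H.minEnergyOn S : ℝ) : ℂ)
      ∀ K' : Submodule ℂ (Fock (Orb (FermionTorus 2 L))), K' ≤ E₀ →
        (∀ X ∈ (Set.range fun v : TorusSite 2 L => (fockTranslate v).val) ∪
            Set.range fun γ : DihedralGroup 4 => (fockD4 (L := L) γ).val, ∀ v ∈ K', X *ᵥ v ∈ K') →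
        K' = ⊥ ∨ K' = E₀) :
    ∀ δ ∈ Set.Icc (1 / 10 : ℝ) (2 / 5), ∃ U₁ : ℝ, 0 < U₁ ∧ ∀ U ∈ Set.Ioc (0 : ℝ) U₁, ∀ ε : ℝ, 0 < ε →
      ∃ L₀ : ℕ, ∀ (L : ℕ) [NeZero L], L₀ ≤ L → Even L →
      ∀ ψ ψ' : Fock (Orb (FermionTorus 2 L)), star ψ ⬝ᵥ ψ = 1 → star ψ' ⬝ᵥ ψ' = 1 →
        IsGroundStateInSector (hubbardTorus 2 L 1 U) (2 * ⌊(1 - δ) * (L : ℝ) ^ 2 / 2⌋₊) 0 ψ →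
        IsGroundStateInSector (hubbardTorus 2 L 1 U) (2 * ⌊(1 - δ) * (L : ℝ) ^ 2 / 2⌋₊) 0 ψ' →
          (expect ((pairField dWaveFormFactor L)ᴴ * pairField dWaveFormFactor L) ψ).re ≤
            (expect ((pairField dWaveFormFactor L)ᴴ * pairField dWaveFormFactor L) ψ').re + ε * (L : ℝ) ^ 4 := by
  refine stub_groundSpaceHomogeneity_of_scalarOnGround fun δ hδ => ?_
  obtain ⟨U₁, hU₁, hU⟩ := h δ hδ
  refine ⟨U₁, hU₁, fun U hUm => ?_⟩
  obtain ⟨L₀, hL₀⟩ := hU U hUm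
  exact ⟨L₀, fun L _ hL hE => scalarOnGround_of_irreducible_latticeSymmetry 1 U _ 0 (hL₀ L hL hE)⟩

/-- **The conditional stub (simple-level form).** `stub_groundSpaceHomogeneity` follows from: for
every doping of the window there is `U₁ > 0` such that for all `U ∈ (0, U₁]`, eventually in even `L`,
the ground level of `hubbardTorus 2 L 1 U` in the sector `(2⌊(1-δ)L²/2⌋, S^z = 0)` is non-degenerate
(`dim E₀ ≤ 1`; `E₀ ≠ ⊥` by `hubbardTorus_groundEigenspace_ne_bot`). NOT proved here.
Tasaki (2020) §2.2. [folklore] -/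
theorem stub_groundSpaceHomogeneity_of_simple
    (h : ∀ δ ∈ Set.Icc (1 / 10 : ℝ) (2 / 5), ∃ U₁ : ℝ, 0 < U₁ ∧ ∀ U ∈ Set.Ioc (0 : ℝ) U₁,
      ∃ L₀ : ℕ, ∀ (L : ℕ) [NeZero L], L₀ ≤ L → Even L →
      let N : ℕ := 2 * ⌊(1 - δ) * (L : ℝ) ^ 2 / 2⌋₊
      let H := hubbardTorus 2 L 1 U
      let S := szSector (Λ := FermionTorus 2 L) N 0
      let E₀ := S ⊓ Module.End.eigenspace (Matrix.toLin' H) ((H.minEnergyOn S : ℝ) : ℂ)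
      Module.finrank ℂ E₀ ≤ 1) :
    ∀ δ ∈ Set.Icc (1 / 10 : ℝ) (2 / 5), ∃ U₁ : ℝ, 0 < U₁ ∧ ∀ U ∈ Set.Ioc (0 : ℝ) U₁, ∀ ε : ℝ, 0 < ε →
      ∃ L₀ : ℕ, ∀ (L : ℕ) [NeZero L], L₀ ≤ L → Even L →
      ∀ ψ ψ' : Fock (Orb (FermionTorus 2 L)), star ψ ⬝ᵥ ψ = 1 → star ψ' ⬝ᵥ ψ' = 1 →
        IsGroundStateInSector (hubbardTorus 2 L 1 U) (2 * ⌊(1 - δ) * (L : ℝ) ^ 2 / 2⌋₊) 0 ψ →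
        IsGroundStateInSector (hubbardTorus 2 L 1 U) (2 * ⌊(1 - δ) * (L : ℝ) ^ 2 / 2⌋₊) 0 ψ' →
          (expect ((pairField dWaveFormFactor L)ᴴ * pairField dWaveFormFactor L) ψ).re ≤
            (expect ((pairField dWaveFormFactor L)ᴴ * pairField dWaveFormFactor L) ψ').re + ε * (L : ℝ) ^ 4 := by
  refine stub_groundSpaceHomogeneity_of_scalarOnGround fun δ hδ => ?_
  obtain ⟨U₁, hU₁, hU⟩ := h δ hδ
  refine ⟨U₁, hU₁, fun U hUm => ?_⟩
  obtain ⟨L₀, hL₀⟩ := hU U hUm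
  exact ⟨L₀, fun L _ hL hE => exists_scalar_matrixElements_of_finrank_le_one _ (hL₀ L hL hE) _⟩

end Summit.HubbardSuperconductivity.TwTipContinuation.IsogapTransport
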